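import Summits.HubbardSuperconductivity.HubbardSuperconductivity.Theorems.AnisotropyChordTransferFibre3L2SlopeArith

/-!
# Route `AnisotropyChord` / H0 rotor rung, LEVEL 2: first-order (slope) interval arithmetic for `RExpr` — soundness of the
# node operations

The semantics of a slope datum (`SD.Holds A δ₂ δ₃ f(x) f(z)`: `f(z) ∈ c`, `f(x) ∈ r`, `f(x) − f(z) = š₂δ₂ + š₃δ₃ + ř` with
`š₂ ∈ s₂, š₃ ∈ s₃, ř ∈ e`) and the inclusion property of every node operation of `…L2SlopeArith` (Neumaier 1990, §2.3,
Thm. 2.3.8 / Prop. 2.3.9, here with an absolute remainder), part 1: `const/still/mov2/mov3_holds`, `add/sub/neg/mul/sq_holds`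
(part 2, `…L2SlopeSoundB`: `inv/abs/sqrt/min/max_holds`, the convex-combination rule `hull_holds`, the centred bounds).  Every proof is elementary interval algebra — no calculus: products by
`f(x)g(x) − f(z)g(z) = f(x)(g(x) − g(z)) + (f(x) − f(z))g(z)`, roots by `√u − √v = (u − v)/(√u + √v)`, `|·|` by
`||u| − |v|| ≤ |u − v|`, `min/max` by "the increment of a max lies between the two increments" + convexity of intervals.
Also the inclusion property `mul_mem_mulZ` of the sign-aware product and the interval-hull lemmas.
Prover seat `hubbard-h0-rotor-p2` g6; helper for piece A = stmt-HubbardSuperconductivity-23918 of rung 19089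
(`--supports`, helper class).  Nothing here proves superconductivity in the Hubbard model; generic helper lemmas serving ONE
conditional reduction (the GM₃ ∀L certificate, Level-2 row `N₁`); the rotor TARGET as originally worded stays FALSE (g15 verdict).
Mathlib + the tree only; no sorry.
-/

set_option linter.dupNamespace false
set_option autoImplicit false

open Literature.Analysis.ValidatedNumerics NonemptyInterval

namespace Summit.HubbardSuperconductivity.HubbardSuperconductivity.Theorems.AnisotropyChord.Transfer.Fibre3.L2

/-! ## Semantics -/

/-- membership in the cast interval, unfolded. -/
theorem memQ {x : ℝ} {I : NonemptyInterval ℚ} : x ∈ I.ratCast ℝ ↔ ((I.fst : ℚ) : ℝ) ≤ x ∧ x ≤ ((I.snd : ℚ) : ℝ) :=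
  mem_ratCast_iff

/-- `0 ∈ [0, 0]`. -/
theorem zero_mem_zI : (0 : ℝ) ∈ zI.ratCast ℝ := by
  rw [zI, ratCast_pure]; exact_mod_cast mem_pure_self (0 : ℝ)

/-- the only point of `[0, 0]` is `0`. -/
theorem eq_zero_of_mem_zI {x : ℝ} (h : x ∈ zI.ratCast ℝ) : x = 0 := by
  rw [zI, ratCast_pure, Rat.cast_zero] at h; exact mem_pure.1 h

/-- `q ∈ [q, q]`. -/
theorem mem_pureQ (q : ℚ) : ((q : ℚ) : ℝ) ∈ (pure q : NonemptyInterval ℚ).ratCast ℝ := by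
  rw [ratCast_pure]; exact mem_pure_self _

/-- the hull contains everything between a point of `I` and a point of `J`. -/
theorem mem_hullI {x y w : ℝ} {I J : NonemptyInterval ℚ} (hx : x ∈ I.ratCast ℝ) (hy : y ∈ J.ratCast ℝ)
    (h1 : Min.min x y ≤ w) (h2 : w ≤ Max.max x y) : w ∈ (hullI I J).ratCast ℝ := by
  rw [memQ] at hx hy ⊢
  simp only [hullI, Rat.cast_min, Rat.cast_max]
  constructor
  · rcases le_total x y with h | h
    · rw [min_eq_left h] at h1; exact (min_le_left _ _).trans (hx.1.trans h1)
    · rw [min_eq_right h] at h1; exact (min_le_right _ _).trans (hy.1.trans h1)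
  · rcases le_total x y with h | h
    · rw [max_eq_right h] at h2; exact h2.trans (hy.2.trans (le_max_right _ _))
    · rw [max_eq_left h] at h2; exact h2.trans (hx.2.trans (le_max_left _ _))

/-- a convex combination of a point of `I` and a point of `J` lies in the hull. -/
theorem convex_mem_hullI {x y θ : ℝ} {I J : NonemptyInterval ℚ} (hx : x ∈ I.ratCast ℝ) (hy : y ∈ J.ratCast ℝ)
    (h0 : 0 ≤ θ) (h1 : θ ≤ 1) : θ * x + (1 - θ) * y ∈ (hullI I J).ratCast ℝ := by
  apply mem_hullI hx hy
  · rcases le_total x y with h | h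
    · rw [min_eq_left h]; nlinarith
    · rw [min_eq_right h]; nlinarith
  · rcases le_total x y with h | h
    · rw [max_eq_right h]; nlinarith
    · rw [max_eq_left h]; nlinarith

/-- the left point lies in the hull. -/
theorem mem_hullI_left {x : ℝ} {I J : NonemptyInterval ℚ} (hx : x ∈ I.ratCast ℝ) : x ∈ (hullI I J).ratCast ℝ := by
  rw [memQ] at hx ⊢
  simp only [hullI, Rat.cast_min, Rat.cast_max]
  exact ⟨(min_le_left _ _).trans hx.1, hx.2.trans (le_max_left _ _)⟩

/-- the right point lies in the hull. -/
theorem mem_hullI_right {y : ℝ} {I J : NonemptyInterval ℚ} (hy : y ∈ J.ratCast ℝ) : y ∈ (hullI I J).ratCast ℝ := by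
  rw [memQ] at hy ⊢
  simp only [hullI, Rat.cast_min, Rat.cast_max]
  exact ⟨(min_le_right _ _).trans hy.1, hy.2.trans (le_max_right _ _)⟩

/-- `θ·x ∈ symI I` for `x ∈ I`, `|θ| ≤ 1`. -/
theorem mem_symI {x θ : ℝ} {I : NonemptyInterval ℚ} (hx : x ∈ I.ratCast ℝ) (hθ : |θ| ≤ 1) :
    θ * x ∈ (symI I).ratCast ℝ := by
  rw [memQ] at hx ⊢
  simp only [symI, Rat.cast_neg, Rat.cast_max, Rat.cast_abs]
  have hxm : |x| ≤ Max.max |((I.fst : ℚ) : ℝ)| |((I.snd : ℚ) : ℝ)| := by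
    rcases le_or_gt 0 x with h | h
    · rw [abs_of_nonneg h]; exact le_max_of_le_right (hx.2.trans (le_abs_self _))
    · rw [abs_of_neg h]; exact le_max_of_le_left (by linarith [neg_abs_le ((I.fst : ℚ) : ℝ), hx.1])
  have h := abs_mul θ x
  have hb : |θ * x| ≤ Max.max |((I.fst : ℚ) : ℝ)| |((I.snd : ℚ) : ℝ)| := by
    rw [h]
    calc |θ| * |x| ≤ 1 * |x| := mul_le_mul_of_nonneg_right hθ (abs_nonneg _)
      _ = |x| := one_mul _
      _ ≤ _ := hxm
  exact ⟨by linarith [neg_abs_le (θ * x)], (le_abs_self _).trans hb⟩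

/-- a real between two rational points lies in the hull of the two point intervals. -/
theorem mem_hullI_pure {w : ℝ} {p q : ℚ} (h1 : (p : ℝ) ≤ w) (h2 : w ≤ q) :
    w ∈ (hullI (pure p) (pure q)).ratCast ℝ :=
  mem_hullI (mem_pureQ p) (mem_pureQ q) ((min_le_left _ _).trans h1) (h2.trans (le_max_right _ _))

/-- ★ inclusion property of the sign-aware product. -/
theorem mul_mem_mulZ {x y : ℝ} {I J : NonemptyInterval ℚ} (hx : x ∈ I.ratCast ℝ) (hy : y ∈ J.ratCast ℝ) :
    x * y ∈ (mulZ I J).ratCast ℝ := by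
  have hx' := memQ.1 hx; have hy' := memQ.1 hy
  have H1 := mul_nonneg (sub_nonneg.2 hx'.1) (sub_nonneg.2 hy'.1)
  have H2 := mul_nonneg (sub_nonneg.2 hx'.1) (sub_nonneg.2 hy'.2)
  have H3 := mul_nonneg (sub_nonneg.2 hx'.2) (sub_nonneg.2 hy'.1)
  have H4 := mul_nonneg (sub_nonneg.2 hx'.2) (sub_nonneg.2 hy'.2)
  unfold mulZ
  split_ifs with hI hJ hJ' hI' hJ2 hJ2' hJ3 hJ3'
  · have hI0 : (0:ℝ) ≤ I.fst := by exact_mod_cast hI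
    have hJ0 : (0:ℝ) ≤ J.fst := by exact_mod_cast hJ
    rw [memQ]; push_cast; constructor <;> nlinarith
  · have hI0 : (0:ℝ) ≤ I.fst := by exact_mod_cast hI
    have hJ0 : ((J.snd:ℚ):ℝ) ≤ 0 := by exact_mod_cast hJ'
    rw [memQ]; push_cast; constructor <;> nlinarith
  · have hI0 : (0:ℝ) ≤ I.fst := by exact_mod_cast hI
    have hJ0 : ((J.fst:ℚ):ℝ) < 0 := by exact_mod_cast (lt_of_not_ge hJ)
    have hJ1 : (0:ℝ) < J.snd := by exact_mod_cast (lt_of_not_ge hJ')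
    rw [memQ]; push_cast; constructor <;> nlinarith
  · have hI0 : ((I.snd:ℚ):ℝ) ≤ 0 := by exact_mod_cast hI'
    have hJ0 : (0:ℝ) ≤ J.fst := by exact_mod_cast hJ2
    rw [memQ]; push_cast; constructor <;> nlinarith
  · have hI0 : ((I.snd:ℚ):ℝ) ≤ 0 := by exact_mod_cast hI'
    have hJ0 : ((J.snd:ℚ):ℝ) ≤ 0 := by exact_mod_cast hJ2'
    rw [memQ]; push_cast; constructor <;> nlinarith
  · have hI0 : ((I.snd:ℚ):ℝ) ≤ 0 := by exact_mod_cast hI'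
    have hJ0 : ((J.fst:ℚ):ℝ) < 0 := by exact_mod_cast (lt_of_not_ge hJ2)
    have hJ1 : (0:ℝ) < J.snd := by exact_mod_cast (lt_of_not_ge hJ2')
    rw [memQ]; push_cast; constructor <;> nlinarith
  · have hI0 : ((I.fst:ℚ):ℝ) < 0 := by exact_mod_cast (lt_of_not_ge hI)
    have hI1 : (0:ℝ) < I.snd := by exact_mod_cast (lt_of_not_ge hI')
    have hJ0 : (0:ℝ) ≤ J.fst := by exact_mod_cast hJ3
    rw [memQ]; push_cast; constructor <;> nlinarith
  · have hI0 : ((I.fst:ℚ):ℝ) < 0 := by exact_mod_cast (lt_of_not_ge hI)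
    have hI1 : (0:ℝ) < I.snd := by exact_mod_cast (lt_of_not_ge hI')
    have hJ0 : ((J.snd:ℚ):ℝ) ≤ 0 := by exact_mod_cast hJ3'
    rw [memQ]; push_cast; constructor <;> nlinarith
  · exact isSoundFun₂_mooreMul hx hy

/-- a real between two reals is a convex combination of them. -/
theorem exists_convex_of_between {u v w : ℝ} (h1 : Min.min u v ≤ w) (h2 : w ≤ Max.max u v) :
    ∃ θ : ℝ, 0 ≤ θ ∧ θ ≤ 1 ∧ w = θ * u + (1 - θ) * v := by
  by_cases huv : u = v
  · subst huv
    simp only [min_self, max_self] at h1 h2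
    exact ⟨0, le_rfl, zero_le_one, by linarith⟩
  · refine ⟨(w - v) / (u - v), ?_, ?_, ?_⟩
    · rcases lt_or_gt_of_ne huv with h | h
      · rw [min_eq_left h.le] at h1; rw [max_eq_right h.le] at h2
        exact div_nonneg_of_nonpos (by linarith) (by linarith)
      · rw [min_eq_right h.le] at h1; rw [max_eq_left h.le] at h2
        exact div_nonneg (by linarith) (by linarith)
    · rcases lt_or_gt_of_ne huv with h | h
      · rw [min_eq_left h.le] at h1
        rw [div_le_one_of_neg (by linarith)]; linarith
      · rw [max_eq_left h.le] at h2
        rw [div_le_one (by linarith)]; linarith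
    · have : u - v ≠ 0 := sub_ne_zero.2 huv
      field_simp
      ring

namespace SD

/-- ★ the meaning of a slope datum at a pair of values `(f(x), f(z))` with increments `(δ₂, δ₃)`:
`f(z) ∈ c`, `f(x) ∈ r`, `f(x) − f(z) = š₂δ₂ + š₃δ₃ + ř` with `š₂ ∈ s₂, š₃ ∈ s₃, ř ∈ e`. -/
structure Holds (A : SD) (δ2 δ3 : ℝ) (fx fz : ℝ) : Prop where
  /-- the centre value -/
  memc : fz ∈ A.c.ratCast ℝ
  /-- the value -/
  memr : fx ∈ A.r.ratCast ℝ
  /-- the linear enclosure of the increment -/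
  lin : ∃ s2 ∈ A.s2.ratCast ℝ, ∃ s3 ∈ A.s3.ratCast ℝ, ∃ r ∈ A.e.ratCast ℝ, fx - fz = s2 * δ2 + s3 * δ3 + r

variable {δ2 δ3 : ℝ}

/-- constants. -/
theorem const_holds (q : ℚ) : (SD.const q).Holds δ2 δ3 q q :=
  ⟨mem_pureQ q, mem_pureQ q, ⟨0, zero_mem_zI, 0, zero_mem_zI, 0, zero_mem_zI, by ring⟩⟩

/-- a still coordinate. -/
theorem still_holds {I : NonemptyInterval ℚ} {y : ℝ} (hy : y ∈ I.ratCast ℝ) : (SD.still I).Holds δ2 δ3 y y :=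
  ⟨hy, hy, ⟨0, zero_mem_zI, 0, zero_mem_zI, 0, zero_mem_zI, by ring⟩⟩

/-- the first moving coordinate (`δ₂ = y − q`). -/
theorem mov2_holds {I : NonemptyInterval ℚ} {y : ℝ} {q : ℚ} (hy : y ∈ I.ratCast ℝ) (hδ : δ2 = y - q) :
    (SD.mov2 q I).Holds δ2 δ3 y q :=
  ⟨mem_pureQ q, hy, ⟨1, by exact_mod_cast mem_pureQ (1 : ℚ), 0, zero_mem_zI, 0, zero_mem_zI, by rw [hδ]; ring⟩⟩

/-- the second moving coordinate (`δ₃ = y − q`). -/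
theorem mov3_holds {I : NonemptyInterval ℚ} {y : ℝ} {q : ℚ} (hy : y ∈ I.ratCast ℝ) (hδ : δ3 = y - q) :
    (SD.mov3 q I).Holds δ2 δ3 y q :=
  ⟨mem_pureQ q, hy, ⟨0, zero_mem_zI, 1, by exact_mod_cast mem_pureQ (1 : ℚ), 0, zero_mem_zI, by rw [hδ]; ring⟩⟩

variable {A B : SD} {fx fz gx gz : ℝ}

/-- a still datum carries equal values. -/
theorem eq_of_isStill (h : A.isStill = true) (hA : A.Holds δ2 δ3 fx fz) : fx = fz := by
  simp only [isStill, Bool.and_eq_true, decide_eq_true_eq] at h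
  obtain ⟨⟨e2, e3⟩, ee⟩ := h
  obtain ⟨a2, ha2, a3, ha3, ar, har, ha⟩ := hA.lin
  rw [e2] at ha2; rw [e3] at ha3; rw [ee] at har
  rw [eq_zero_of_mem_zI ha2, eq_zero_of_mem_zI ha3, eq_zero_of_mem_zI har] at ha
  linarith

/-- unpacking `both0`. -/
theorem both0_spec (h : both0 A B = true) : A.isStill = true ∧ B.isStill = true ∧ A.c = A.r ∧ B.c = B.r := by
  simpa [both0, Bool.and_eq_true, decide_eq_true_eq, and_assoc] using h

/-- a non-moving pair of values `(v, v)` is enclosed by `(r, r, 0, 0, 0)` once `v ∈ r`. -/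
theorem still_pair_holds {I : NonemptyInterval ℚ} {vx vz : ℝ} (hz : vz ∈ I.ratCast ℝ) (hx : vx ∈ I.ratCast ℝ)
    (he : vx = vz) : (⟨I, I, zI, zI, zI⟩ : SD).Holds δ2 δ3 vx vz :=
  ⟨hz, hx, ⟨0, zero_mem_zI, 0, zero_mem_zI, 0, zero_mem_zI, by rw [he]; ring⟩⟩

/-- sum. -/
theorem add_holds (prec : ℕ) (hA : A.Holds δ2 δ3 fx fz) (hB : B.Holds δ2 δ3 gx gz) :
    (A.add prec B).Holds δ2 δ3 (fx + gx) (fz + gz) := by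
  obtain ⟨a2, ha2, a3, ha3, ar, har, ha⟩ := hA.lin
  obtain ⟨b2, hb2, b3, hb3, br, hbr, hb⟩ := hB.lin
  unfold SD.add
  split_ifs with h0
  · obtain ⟨hsA, hsB, hcA, hcB⟩ := both0_spec h0
    have hcz := isSoundFun₂_add hA.memc hB.memc
    rw [hcA, hcB] at hcz
    exact still_pair_holds (mem_roundOut prec hcz) (mem_roundOut prec (isSoundFun₂_add hA.memr hB.memr))
      (by rw [eq_of_isStill hsA hA, eq_of_isStill hsB hB])
  exact ⟨mem_roundOut prec (isSoundFun₂_add hA.memc hB.memc), mem_roundOut prec (isSoundFun₂_add hA.memr hB.memr),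
    ⟨a2 + b2, mem_roundOut prec (isSoundFun₂_add ha2 hb2), a3 + b3, mem_roundOut prec (isSoundFun₂_add ha3 hb3),
      ar + br, mem_roundOut prec (isSoundFun₂_add har hbr), by rw [add_sub_add_comm, ha, hb]; ring⟩⟩

/-- difference. -/
theorem sub_holds (prec : ℕ) (hA : A.Holds δ2 δ3 fx fz) (hB : B.Holds δ2 δ3 gx gz) :
    (A.sub prec B).Holds δ2 δ3 (fx - gx) (fz - gz) := by
  obtain ⟨a2, ha2, a3, ha3, ar, har, ha⟩ := hA.lin
  obtain ⟨b2, hb2, b3, hb3, br, hbr, hb⟩ := hB.lin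
  unfold SD.sub
  split_ifs with h0
  · obtain ⟨hsA, hsB, hcA, hcB⟩ := both0_spec h0
    have hcz := isSoundFun₂_sub hA.memc hB.memc
    rw [hcA, hcB] at hcz
    exact still_pair_holds (mem_roundOut prec hcz) (mem_roundOut prec (isSoundFun₂_sub hA.memr hB.memr))
      (by rw [eq_of_isStill hsA hA, eq_of_isStill hsB hB])
  exact ⟨mem_roundOut prec (isSoundFun₂_sub hA.memc hB.memc), mem_roundOut prec (isSoundFun₂_sub hA.memr hB.memr),
    ⟨a2 - b2, mem_roundOut prec (isSoundFun₂_sub ha2 hb2), a3 - b3, mem_roundOut prec (isSoundFun₂_sub ha3 hb3),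
      ar - br, mem_roundOut prec (isSoundFun₂_sub har hbr), by rw [sub_sub_sub_comm, ha, hb]; ring⟩⟩

/-- negation. -/
theorem neg_holds (hA : A.Holds δ2 δ3 fx fz) : A.neg.Holds δ2 δ3 (-fx) (-fz) := by
  obtain ⟨a2, ha2, a3, ha3, ar, har, ha⟩ := hA.lin
  exact ⟨isSoundFun_neg hA.memc, isSoundFun_neg hA.memr,
    ⟨-a2, isSoundFun_neg ha2, -a3, isSoundFun_neg ha3, -ar, isSoundFun_neg har, by
      have : -fx - -fz = -(fx - fz) := by ring
      rw [this, ha]; ring⟩⟩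

/-- product (`f(x)g(x) − f(z)g(z) = f(x)(g(x) − g(z)) + (f(x) − f(z))g(z)`). -/
theorem mul_holds (prec : ℕ) (hA : A.Holds δ2 δ3 fx fz) (hB : B.Holds δ2 δ3 gx gz) :
    (A.mul prec B).Holds δ2 δ3 (fx * gx) (fz * gz) := by
  obtain ⟨a2, ha2, a3, ha3, ar, har, ha⟩ := hA.lin
  obtain ⟨b2, hb2, b3, hb3, br, hbr, hb⟩ := hB.lin
  have hcc := mem_roundOut prec (mul_mem_mulZ hA.memc hB.memc)
  have hrr := mem_roundOut prec (mul_mem_mulZ hA.memr hB.memr)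
  have key : fx * gx - fz * gz = fx * (gx - gz) + (fx - fz) * gz := by ring
  unfold SD.mul
  split_ifs with hB0 h00 hA0
  · -- both still, centre = range: one product
    obtain ⟨hsA, hsB, hcA, hcB⟩ := both0_spec h00
    have hcz := mul_mem_mulZ hA.memc hB.memc
    rw [hcA, hcB] at hcz
    exact still_pair_holds (mem_roundOut prec hcz) hrr (by rw [eq_of_isStill hsA hA, eq_of_isStill hsB hB])
  · -- `g` still: `s = c_g·s_f`
    have hg : gx = gz := eq_of_isStill hB0 hB
    refine ⟨hcc, hrr, ⟨gz * a2, mem_roundOut prec (mul_mem_mulZ hB.memc ha2), gz * a3,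
      mem_roundOut prec (mul_mem_mulZ hB.memc ha3), gz * ar, mem_roundOut prec (mul_mem_mulZ hB.memc har), ?_⟩⟩
    rw [key, hg, sub_self, mul_zero, zero_add, ha]; ring
  · -- `f` still: `s = r_f·s_g`
    have hf : fx = fz := eq_of_isStill hA0 hA
    refine ⟨hcc, hrr, ⟨fx * b2, mem_roundOut prec (mul_mem_mulZ hA.memr hb2), fx * b3,
      mem_roundOut prec (mul_mem_mulZ hA.memr hb3), fx * br, mem_roundOut prec (mul_mem_mulZ hA.memr hbr), ?_⟩⟩
    rw [key, hf, sub_self, zero_mul, add_zero, hb]; ring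
  · refine ⟨hcc, hrr,
      ⟨fx * b2 + gz * a2, mem_roundOut prec (isSoundFun₂_add (mul_mem_mulZ hA.memr hb2) (mul_mem_mulZ hB.memc ha2)),
       fx * b3 + gz * a3, mem_roundOut prec (isSoundFun₂_add (mul_mem_mulZ hA.memr hb3) (mul_mem_mulZ hB.memc ha3)),
       fx * br + gz * ar, mem_roundOut prec (isSoundFun₂_add (mul_mem_mulZ hA.memr hbr) (mul_mem_mulZ hB.memc har)),
       ?_⟩⟩
    rw [key, ha, hb]; ring

/-- square (`f(x)² − f(z)² = (f(x) + f(z))(f(x) − f(z))`). -/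
theorem sq_holds (prec : ℕ) (hA : A.Holds δ2 δ3 fx fz) : (A.sq prec).Holds δ2 δ3 (fx ^ 2) (fz ^ 2) := by
  obtain ⟨a2, ha2, a3, ha3, ar, har, ha⟩ := hA.lin
  have hcc := mem_roundOut prec (sq_mem_sqI hA.memc)
  have hrr := mem_roundOut prec (sq_mem_sqI hA.memr)
  unfold SD.sq
  split_ifs with h0 hcr
  · have hcz := sq_mem_sqI hA.memc
    rw [hcr] at hcz
    exact still_pair_holds (mem_roundOut prec hcz) hrr (by rw [eq_of_isStill h0 hA])
  · exact ⟨hcc, hrr, ⟨0, zero_mem_zI, 0, zero_mem_zI, 0, zero_mem_zI, by rw [eq_of_isStill h0 hA]; ring⟩⟩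
  · have hw : fx + fz ∈ (A.r + A.c).ratCast ℝ := isSoundFun₂_add hA.memr hA.memc
    refine ⟨hcc, hrr, ⟨(fx + fz) * a2, mem_roundOut prec (mul_mem_mulZ hw ha2), (fx + fz) * a3,
      mem_roundOut prec (mul_mem_mulZ hw ha3), (fx + fz) * ar, mem_roundOut prec (mul_mem_mulZ hw har), ?_⟩⟩
    have : fx ^ 2 - fz ^ 2 = (fx + fz) * (fx - fz) := by ring
    rw [this, ha]; ring

end SD

end Summit.HubbardSuperconductivity.HubbardSuperconductivity.Theorems.AnisotropyChord.Transfer.Fibre3.L2
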